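import Summits.HodgeConjecture.HodgeConjecture.Theorems.HCCMUnconditionalHD3OfTwistRigidity
import Literature.RepresentationTheory.MoeglinVignerasWaldspurger1987.RankOneThetaLiftNonPeriodicOfCharacter
import Literature.RepresentationTheory.MoeglinVignerasWaldspurger1987.RankOneThetaLiftTwistRigidityOfNonPeriodicGlue
import Literature.RepresentationTheory.MoeglinVignerasWaldspurger1987.RankOneTorusTrace
import Literature.RepresentationTheory.MoeglinVignerasWaldspurger1987.RankOneTorusBigCell
import HarnessLib

/-!
# `HCCMUnconditional.HD3` — CLOSING FILE of item stmt-HodgeConjecture-24837 (binder `hD3`, [Liu 2021, App. D Lem. D.1 (3)] AS PRINTED)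

Topic: summit `HodgeConjecture`, sub-problem `HodgeConjecture`, route `HCCMUnconditional` (Theses file of record), crux `HD3`
(= the pack decl `PrintedCitationHypotheses.HypD3`: [Liu 2021, App. D Lem. D.1 (3)] AS PRINTED, per finite place `v` of `F⁺`,
`n = 3`, on the indexed family of the tree's local data).  PROVER FILE (cell `hodgecm-mathlib`, seat A-p13 = HD3 closing
custodian, director g2 batch 53; D-0016): theorems only, sorry-free, axioms ⊆ the trio.

CHAIN OF RECORD (every link a tree theorem, consumed BY NAME):
* line `a4-liuD3` head with S6a and IV-4(c1) discharged: `CorCM.HypD3.hD3_of_twistRigidity (hc3 : rankOne_theta_twist_rigidity)`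
  (A-p15 p607725 over B-p19 `hD3_of_lineRigidityS6a`, B-p14 `HypD3.lineRigidityS6a`, B-p10 `rankOne_theta_lines_disjoint_holds`);
* route R for IV-4(c3): `rankOne_theta_twist_rigidity_of_nonPeriodic₁₁' (hNP)` (B-p03 p610504 = B-p18's wrapper p606210 with the
  frame transport `twistRigid_of_frame` (p609987) and the block reduction `twistRigid_block` discharged);
* the c3 WALL `hNP` (rank `1 × 1` non-periodicity of the `(U(1), U(1))` oscillator types) by the CHARACTER ROUTE:
  `nonPeriodic₁₁_of_torusTrace (hTR)` (B-p18 p609307) over (M1) multiplicity one (A-p13 p607713/p608881,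
  `RankOneOscillatorMultiplicityOne`), (M2) the finite-level trace identity (B-p21 p608305) and the torus-trace
  non-vanishing `TR` = the finite-level form of Howe's character formula `|Θ_ω(z₀)| = |N_{E_v/F_v}(1 − z₀)|^{-1/2} ≠ 0`
  ([Howe1973]; H2 B-p04 p609524 `SchrodingerBigCellTrace`, H1 B-p17/B-p21 `RankOneTorusBigCell`, assembly B-p04
  `rankOne_torusTrace_ne_zero`).

§1 `HD3_of_torusTrace (hTR) : HCCMUnconditional.HD3` — the crux from the torus-trace statement `TR` ALONE (binder text = B-p04's
TR signature of record 7ff23631248a52d5 = the hypothesis of `nonPeriodic₁₁_of_torusTrace`, character for character).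
§1b `HD3_of_bigCellPackage (hH1) : HCCMUnconditional.HD3` — the crux from the torus big-cell package H1 ALONE (binder text = the
`hpkg` hypothesis of B-p04's `rankOne_torusTrace_ne_zero_of_bigCellPackage` p610172 ∀-closed over the TR binders, a Haar measure and the
conductor exponent — the H1 text of record, arbiter ruling #4 / B-p11's slot 30cf2e52078ddb43), through TR by B-p04's junction recipe
(Borel σ-algebra, `Measure.addHaar`, `exists_hasConductorExp`).
§2 `HD3_proof : HCCMUnconditional.HD3` — the GATE-SHAPE HEAD closing the item: `HD3_of_bigCellPackage` fed with the landed H1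
`rankOne_torus_bigCell_package` (B-p17 p612837, with B-p21/B-p03/B-p11/A-p15 pieces).

HC_CM is proved only modulo the 7 printed citations until rung 0 closes; this file discharges `hD3` (then 4 remain: `hDel`, `h21`,
`hLiu418`, `h413`).

## References
* [Liu2021] Y. Liu, *Fourier–Jacobi cycles and arithmetic relative trace formula*, Camb. J. Math. 9 (2021) = arXiv:2102.11518:
  App. D Lem. D.1 (3) (l. 5233), proof l. 5249–5255.
* [MoeglinVignerasWaldspurger1987] LNM 1291 (1987), Chap. 3 IV.4; Chap. 2 II Remarque (3).  [Kudla1994] Israel J. Math. 87, §3 Thm. 3.1.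
* [Howe1973] R. Howe, On the character of Weil's representation, Trans. AMS 177 (1973).
-/

set_option autoImplicit false

-- `Summit.HodgeConjecture.HodgeConjecture.Theorems` is the mandated namespace (single-problem summit: Problem = Summit), which
-- `linter.dupNamespace` flags; the lakefile turns the linter off tree-wide (weak option), restated here so stand-alone elaboration is
-- warning-free too.
set_option linter.dupNamespace false

noncomputable section

open NumberField IsDedekindDomain
open scoped Matrix
open Literature.RepresentationTheory.HeisenbergGroup (MpPsi)
open Literature.NumberTheory.GelbartRogawski1991.UnitaryDualPair.LocalSplitting (iota LocalMp localSchrodinger)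
open Literature.NumberTheory.Automorphic (SchwartzBruhat UnitaryGroup.localPi UnitaryGroup.LocalRing)

namespace Summit.HodgeConjecture.HodgeConjecture.Theorems

/-- **§1 `HCCMUnconditional.HD3` from the torus-trace statement `TR` alone.**  For every `1 × 1` Gram matrix `t`, non-split
place `v`, smooth section `s₁` of `U(J₁)(F_v) = E_v¹` over `ι_v` and `z₀` with `z₀² ≠ 1`: for all small open `K` and every
finite-dimensional `K`-fixed subspace `W` of `𝒮(F_v)`, `tr(ω_{s₁}(z₀) | W) ≠ 0` (the finite-level form of Howe's character formula)
⟹ [Liu 2021, App. D Lem. D.1 (3)] AS PRINTED at every finite place of `F⁺` on the face family (`hD3`).  Composition BY NAME: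
`hD3_of_twistRigidity ∘ rankOne_theta_twist_rigidity_of_nonPeriodic₁₁' ∘ nonPeriodic₁₁_of_torusTrace`.
[cite: Liu2021, App. D Lem. D.1 (3) (l. 5233), proof l. 5249–5255] [cite: MoeglinVignerasWaldspurger1987, Chap. 3 IV.4]
[cite: Howe1973, Theorem (character of the oscillator representation)] -/
theorem HD3_of_torusTrace
    (hTR : ∀ (F : Type) [Field F] [NumberField F] (E : Type) [Field E] [NumberField E] [Algebra F E]
      [Algebra.IsQuadraticExtension F E] (c : E ≃ₐ[F] E) (δ : E) (hcδ : c δ = -δ) (hδ : δ ≠ 0) (d : F)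
      (hd : δ * δ = algebraMap F E d) (t : Matrix (Fin 1) (Fin 1) F) (ht : t.IsSymm) (htd : IsUnit t.det)
      (J₁ : Matrix (Fin 1) (Fin 1) E) (hJ₁ : J₁ = t.map (algebraMap F E)) (v : HeightOneSpectrum (𝓞 F))
      (hE : IsField (UnitaryGroup.LocalRing E v))
      (s₁ : UnitaryGroup.localPi E c 1 J₁ v →* LocalMp F 1 t v)
      (hs₁ : ∀ g, MpPsi.proj _ (s₁ g) = iota F E c 1 hcδ hδ hd t ht hJ₁ v g)
      (hsm₁ : Representation.IsSmooth ((MpPsi.toRep (localSchrodinger F 1 t v)).comp s₁))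
      (z₀ : UnitaryGroup.localPi E c 1 J₁ v) (hz₀ : z₀ * z₀ ≠ 1),
      ∃ K₀ : Subgroup (UnitaryGroup.localPi E c 1 J₁ v), IsOpen (K₀ : Set (UnitaryGroup.localPi E c 1 J₁ v)) ∧
        ∀ K : Subgroup (UnitaryGroup.localPi E c 1 J₁ v), IsOpen (K : Set (UnitaryGroup.localPi E c 1 J₁ v)) → K ≤ K₀ →
          ∀ (W : Submodule ℂ (SchwartzBruhat (Fin 1 → v.adicCompletion F))) [FiniteDimensional ℂ W],
            (∀ f, f ∈ W ↔ ∀ k ∈ K, ((MpPsi.toRep (localSchrodinger F 1 t v)).comp s₁) k f = f) →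
            ∀ hW : ∀ w ∈ W, ((MpPsi.toRep (localSchrodinger F 1 t v)).comp s₁) z₀ w ∈ W,
              LinearMap.trace ℂ W ((((MpPsi.toRep (localSchrodinger F 1 t v)).comp s₁) z₀).restrict hW) ≠ 0) :
    Summit.HodgeConjecture.HodgeConjecture.Theses.HCCMUnconditional.HD3 :=
  Summit.HodgeConjecture.CorCM.HypD3.hD3_of_twistRigidity
    (Literature.RepresentationTheory.MoeglinVignerasWaldspurger1987.rankOne_theta_twist_rigidity_of_nonPeriodic₁₁'
      (Literature.RepresentationTheory.MoeglinVignerasWaldspurger1987.nonPeriodic₁₁_of_torusTrace hTR))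

section BigCellPackage

open MeasureTheory
open Literature.RepresentationTheory.HeisenbergGroup
open Literature.RepresentationTheory.MoeglinVignerasWaldspurger1987
open Literature.NumberTheory.Automorphic
open Literature.NumberTheory.GaloisRepresentations.IsNonarchimedeanLocalField
open Literature.NumberTheory.Weil1964

/-- **§1b `HCCMUnconditional.HD3` from the torus big-cell package H1 alone.**  H1 (the text of record = the `hpkg` hypothesis of
`rankOne_torusTrace_ne_zero_of_bigCellPackage`, ∀-closed): at every non-split place, for every `1 × 1` Gram matrix, smooth section `s₁`
over `ι_v`, `z₀` with `z₀² ≠ 1`, Haar measure `μ` and conductor exponent `m` of `ψ_v`, there is an open `K₀ ≤ U(J₁)(F_v)` on which the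
operators `ω_{s₁}(z₀k)` are canonical big-cell words of the dot model with a common kernel prefactor `cc ≠ 0`, a common deep Gauss value
`Gv ≠ 0` of their diagonals, and uniformly bounded cells.  Then `hD3` holds: H1 ⟹ TR (`rankOne_torusTrace_ne_zero_of_bigCellPackage` at the
Borel σ-algebra, `Measure.addHaar` and a conductor exponent of `ψ_v`) ⟹ `HD3_of_torusTrace`.
[cite: Liu2021, App. D Lem. D.1 (3) (l. 5233), proof l. 5249–5255] [cite: Weil1964, n° 13 (29) p. 160]
[cite: Howe1973, Theorem (character of the oscillator representation)] -/
theorem HD3_of_bigCellPackage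
    (hH1 : ∀ (F : Type) [Field F] [NumberField F] (E : Type) [Field E] [NumberField E] [Algebra F E]
      [Algebra.IsQuadraticExtension F E] (c : E ≃ₐ[F] E) (δ : E) (hcδ : c δ = -δ) (hδ : δ ≠ 0) (d : F)
      (hd : δ * δ = algebraMap F E d) (t : Matrix (Fin 1) (Fin 1) F) (ht : t.IsSymm) (htd : IsUnit t.det)
      (J₁ : Matrix (Fin 1) (Fin 1) E) (hJ₁ : J₁ = t.map (algebraMap F E)) (v : HeightOneSpectrum (𝓞 F))
      (hE : IsField (UnitaryGroup.LocalRing E v))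
      (s₁ : UnitaryGroup.localPi E c 1 J₁ v →* LocalMp F 1 t v)
      (hs₁ : ∀ g, MpPsi.proj _ (s₁ g) = iota F E c 1 hcδ hδ hd t ht hJ₁ v g)
      (hsm₁ : Representation.IsSmooth ((MpPsi.toRep (localSchrodinger F 1 t v)).comp s₁))
      (z₀ : UnitaryGroup.localPi E c 1 J₁ v) (hz₀ : z₀ * z₀ ≠ 1)
      [MeasurableSpace (v.adicCompletion F)] [BorelSpace (v.adicCompletion F)]
      (μ : Measure (v.adicCompletion F)) [μ.IsAddHaarMeasure] (m : ℤ) (hm : (adeleAddCharAt F v).HasConductorExp m),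
      ∃ K₀ : Subgroup (UnitaryGroup.localPi E c 1 J₁ v), IsOpen (K₀ : Set (UnitaryGroup.localPi E c 1 J₁ v)) ∧
        ∃ (γ_ δ_ : UnitaryGroup.localPi E c 1 J₁ v →
            ((Fin 1 → v.adicCompletion F) →ₗ[v.adicCompletion F] (Fin 1 → v.adicCompletion F)))
          (B_ : UnitaryGroup.localPi E c 1 J₁ v →
            ((Fin 1 → v.adicCompletion F) ≃ₗ[v.adicCompletion F] (Fin 1 → v.adicCompletion F)))
          (cc Gv : ℂ) (m₀ e₀ : ℤ), cc ≠ 0 ∧ Gv ≠ 0 ∧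
          (∀ k ∈ K₀, ∀ f : SchwartzBruhat (Fin 1 → v.adicCompletion F),
            ((MpPsi.toRep (localSchrodinger F 1 t v)).comp s₁) (z₀ * k) f = (cc * (modSqrt (B_ k) : ℂ)) •
              ((unipOpPi (isLocallyConstant_of_isContinuousNontrivial (isContinuousNontrivial_adeleAddCharAt F v)) (γ_ k) *
                leviOpPi (B_ k) * fourierOpPi μ (isContinuousNontrivial_adeleAddCharAt F v) hm *
                unipOpPi (isLocallyConstant_of_isContinuousNontrivial (isContinuousNontrivial_adeleAddCharAt F v)) (δ_ k) :
                  SchwartzBruhat (Fin 1 → v.adicCompletion F) ≃ₗ[ℂ] SchwartzBruhat (Fin 1 → v.adicCompletion F)) f)) ∧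
          (∀ k ∈ K₀, ∀ n ≤ m₀,
            ∫ x in primePowPiBox (v.adicCompletion F) (Fin 1) n,
              (((adeleAddCharAt F v) (x ⬝ᵥ (B_ k).symm x - halfForm (γ_ k) x - halfForm (δ_ k) x) : Circle) : ℂ)
                ∂(Measure.pi fun _ : Fin 1 => μ) = Gv) ∧
          (∀ k ∈ K₀, ∀ (a : ℤ) (x : Fin 1 → v.adicCompletion F), x ∈ primePowPiBox (v.adicCompletion F) (Fin 1) a →
            γ_ k x ∈ primePowPiBox (v.adicCompletion F) (Fin 1) (a - e₀) ∧
              (B_ k).symm x ∈ primePowPiBox (v.adicCompletion F) (Fin 1) (a - e₀) ∧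
                δ_ k x ∈ primePowPiBox (v.adicCompletion F) (Fin 1) (a - e₀))) :
    Summit.HodgeConjecture.HodgeConjecture.Theses.HCCMUnconditional.HD3 :=
  HD3_of_torusTrace fun F _ _ E _ _ _ _ c δ hcδ hδ d hd t ht htd J₁ hJ₁ v hE s₁ hs₁ hsm₁ z₀ hz₀ => by
    letI : MeasurableSpace (v.adicCompletion F) := borel _
    haveI : BorelSpace (v.adicCompletion F) := ⟨rfl⟩
    obtain ⟨m, hm⟩ := (isContinuousNontrivial_adeleAddCharAt F v).exists_hasConductorExp
    exact rankOne_torusTrace_ne_zero_of_bigCellPackage F E c δ hcδ hδ t htd J₁ hJ₁ v hE s₁ hsm₁ z₀ Measure.addHaar m hm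
      (hH1 F E c δ hcδ hδ d hd t ht htd J₁ hJ₁ v hE s₁ hs₁ hsm₁ z₀ hz₀ Measure.addHaar m hm)

end BigCellPackage

/-- **§2 `HD3_proof` — GATE-SHAPE HEAD closing item stmt-HodgeConjecture-24837 (binder `hD3` of the headline
`hc_cm_of_printed_citations_muKey_ident_lemD3_delRecConjOmegaT`)**: [Liu 2021, App. D Lem. D.1 (3)] AS PRINTED at every finite place of
`F⁺` on the face family, UNCONDITIONALLY — `HD3_of_bigCellPackage` fed with the torus big-cell package H1
`rankOne_torus_bigCell_package` (B-p17 p612837 `RankOneTorusBigCell`; pieces B-p21, B-p03, B-p11, A-p15), hence through B-p04's finite-level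
trace H2 `trace_restrict_fixed_eq_of_bigCell_family` (p609524), the finite-level trace identity (B-p21 p608305), multiplicity one
(A-p13 p607713), the assembly `nonPeriodic₁₁_of_torusTrace` (B-p18 p609307), route R `rankOne_theta_twist_rigidity_of_nonPeriodic₁₁'`
(B-p03 p610504) and the line head `hD3_of_twistRigidity` (A-p15 p607725).  With this theorem the binder `hD3` is discharged in-tree;
HC_CM is proved only modulo the 7 printed citations until rung 0 closes (after `h411`, `hD1''`, `hD3`: four remain — `hDel`, `h21`,
`hLiu418`, `h413`). [cite: Liu2021, App. D Lem. D.1 (3) (l. 5233), proof l. 5249–5255] [cite: MoeglinVignerasWaldspurger1987, Chap. 3 IV.4]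
[cite: Howe1973, Theorem (character of the oscillator representation)] -/
theorem HD3_proof : Summit.HodgeConjecture.HodgeConjecture.Theses.HCCMUnconditional.HD3 :=
  HD3_of_bigCellPackage Literature.RepresentationTheory.MoeglinVignerasWaldspurger1987.rankOne_torus_bigCell_package

end Summit.HodgeConjecture.HodgeConjecture.Theorems

end
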